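import Summits.Ventures.PercRepro.C041TriangleSeedRegion2

/-!
# LEAF-CURVE MOMENT ELEMENTS ARE CONE ELEMENTS (mine-3, gen 63; C-041.md §21 (aw))

The leaf curve is quadratic in the fugacity: `v t = v 0 + t • d + t ^ 2 • q` with `d = (0, 0, −2, 1, 1, −1)` and
`q = (0, 1, 1, −1, 0, 0)` (`v_eq_leaf_moments`).  Hence a six-vector `λ • 1 + m₀ • v 0 + m₁ • d + m₂ • q` («a leaf-curve
moment element») is `λ` copies of the empty leaf plus a measure on the leaf curve with moments `(m₀, m₁, m₂)`, and it lies in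
the cone as soon as the truncated Hausdorff conditions hold: `0 ≤ λ`, `0 ≤ m₂ ≤ m₁ ≤ m₀` and the Hankel condition
`m₁ ^ 2 ≤ m₀ m₂` (`InCone_leaf_moments`): the lower principal representation puts mass `m₀ − m₁ ^ 2 / m₂` at the leaf `0`
and mass `m₁ ^ 2 / m₂` at the leaf `m₂ / m₁` (`leaf_moments_eq_principal`).  Multiplied by a cone prefactor `G` this is the
certificate form `Σ_G G ∘ (λ_G • 1 + m₀ᴳ • v 0 + m₁ᴳ • d + m₂ᴳ • q)` used for the last seed on the tiny-leaf region
(`C041TriangleSeedCorner`).  No definition is introduced (the element is always written out).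
-/

namespace PercRepro

namespace RelaxedTriangle

open TreeClosure

/-- The leaf curve is quadratic in the fugacity: `v t = v 0 + t • d + t ^ 2 • q`. -/
theorem v_eq_leaf_moments (t : ℝ) :
    v t = (0 : ℝ) • (1 : Vec6) + (1 : ℝ) • v 0 + t • ![0, 0, -2, 1, 1, -1] + t ^ 2 • ![0, 1, 1, -1, 0, 0] := by
  ext i
  simp only [v, Pi.add_apply, Pi.smul_apply, Pi.one_apply, smul_eq_mul]
  fin_cases i <;> simp <;> ring

/-- **THE LOWER PRINCIPAL REPRESENTATION**: for `m₁ ≠ 0`, `m₂ ≠ 0`, the moment element equals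
`λ • 1 + (m₀ − m₁ ^ 2 / m₂) • v 0 + (m₁ ^ 2 / m₂) • v (m₂ / m₁)`. -/
theorem leaf_moments_eq_principal (lam m0 m1 m2 : ℝ) (h1 : m1 ≠ 0) (h2 : m2 ≠ 0) :
    lam • (1 : Vec6) + m0 • v 0 + m1 • ![0, 0, -2, 1, 1, -1] + m2 • ![0, 1, 1, -1, 0, 0] = lam • (1 : Vec6) + (m0 - m1 ^ 2 / m2) • v 0 + (m1 ^ 2 / m2) • v (m2 / m1) := by
  ext i
  simp only [v, Pi.add_apply, Pi.smul_apply, Pi.one_apply, smul_eq_mul]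
  fin_cases i <;> simp <;> field_simp <;> ring

/-- **A LEAF-CURVE MOMENT ELEMENT LIES IN THE CONE** when `0 ≤ λ`, `0 ≤ m₂ ≤ m₁ ≤ m₀` and `m₁ ^ 2 ≤ m₀ m₂`. -/
theorem InCone_leaf_moments {lam m0 m1 m2 : ℝ} (h0 : 0 ≤ lam) (h2 : 0 ≤ m2) (h12 : m2 ≤ m1) (h01 : m1 ≤ m0)
    (hH : m1 ^ 2 ≤ m0 * m2) :
    InCone (lam • (1 : Vec6) + m0 • v 0 + m1 • ![0, 0, -2, 1, 1, -1] + m2 • ![0, 1, 1, -1, 0, 0]) := by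
  rcases eq_or_lt_of_le h2 with h2z | h2p
  · -- `m₂ = 0` forces `m₁ = 0`: the measure is `m₀` copies of the leaf `0`
    subst h2z
    have h1 : m1 = 0 := by nlinarith [sq_nonneg m1]
    subst h1
    have hm0 : 0 ≤ m0 := h01
    have e : lam • (1 : Vec6) + m0 • v 0 + (0 : ℝ) • ![0, 0, -2, 1, 1, -1] + (0 : ℝ) • ![0, 1, 1, -1, 0, 0]
        = lam • (1 : Vec6) + m0 • v 0 := by
      ext i
      simp only [Pi.add_apply, Pi.smul_apply, Pi.one_apply, smul_eq_mul]
      ring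
    rw [e]
    exact (InCone_one.smul lam h0).add ((InCone_v 0 ⟨le_rfl, zero_le_one⟩).smul m0 hm0)
  · have h1p : 0 < m1 := lt_of_lt_of_le h2p h12
    rw [leaf_moments_eq_principal lam m0 m1 m2 h1p.ne' h2p.ne']
    have ht0 : 0 ≤ m2 / m1 := div_nonneg h2 h1p.le
    have ht1 : m2 / m1 ≤ 1 := by rw [div_le_one h1p]; exact h12
    have hc : 0 ≤ m0 - m1 ^ 2 / m2 := by
      rw [sub_nonneg, div_le_iff₀ h2p]
      exact hH
    exact ((InCone_one.smul lam h0).add ((InCone_v 0 ⟨le_rfl, zero_le_one⟩).smul _ hc)).add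
      ((InCone_v _ ⟨ht0, ht1⟩).smul _ (by positivity))

/-- A cone prefactor times a leaf-curve moment element lies in the cone. -/
theorem InCone.mul_leaf_moments {G : Vec6} (hG : InCone G) {lam m0 m1 m2 : ℝ} (h0 : 0 ≤ lam) (h2 : 0 ≤ m2)
    (h12 : m2 ≤ m1) (h01 : m1 ≤ m0) (hH : m1 ^ 2 ≤ m0 * m2) :
    InCone (G * (lam • (1 : Vec6) + m0 • v 0 + m1 • ![0, 0, -2, 1, 1, -1] + m2 • ![0, 1, 1, -1, 0, 0])) :=
  hG.mul (InCone_leaf_moments h0 h2 h12 h01 hH)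

end RelaxedTriangle

end PercRepro
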